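import Literature.AlgebraicGeometry.HodgeTheory.HyperplaneClassPullback
import Literature.AlgebraicGeometry.HodgeTheory.FubiniStudyClassRational
import Literature.AlgebraicGeometry.Motives.ProjectiveSpaceFunctionField
import Literature.NumberTheory.Transcendental.AnalytificationProjProofs
import HarnessLib

/-!
# The affine coordinates of `ℙᴺ_ℂ` at the complex point `[z₀ : ⋯ : z_N]`: `(xᵢ/xⱼ)([z]) = zᵢ/zⱼ`

Layer `Literature/AlgebraicGeometry/HodgeTheory`, namespace `Literature.AlgebraicGeometry.HodgeTheory`.
THEOREMS ONLY (no definition, no named fact, no instance).  Generic plumbing leaf (cell `hodgecm-mathlib`,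
(U)-lane node U-aΘ, leaf (L4-p) of the census `B-provers/B-p07/CENSUS-UaTheta-L4.B-p07g12.md`): it feeds the
hypotheses `hdom` / `hcoord` of ★ `HodgeTheory.picClass_cartierDivisorLineBundle_divisor_eq_toPic`
(`ThetaMapHyperplaneClass`) from the conclusion `AlgPoints.map ι (ψ m) = projPoint N (F m)` of the algebraisation
package ★ `AbelianVarieties.exists_smoothProjective_of_projectiveEmbedding`.

For the comparison map `projPoint N : ℙ(ℂ^{N+1}) → ℙᴺ_ℂ(ℂ)` (Serre, GAGA §2 n°5) and the affine coordinate
functions `coordFun (𝟙 ℙᴺ) (projPoint N) j` of `Motives.AnalytificationKaehler` (the ratios `xᵢ/xⱼ` of the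
generating sections of `𝟙 ℙᴺ`, Hartshorne II Thm. 7.1 (a), read on `ℙ(ℂ^{N+1})`):

* `mem_chartDom_id_projPoint_mk_iff` — `[z] ∈ (projPoint N)⁻¹(D₊(xⱼ)(ℂ))` iff `zⱼ ≠ 0`;
* `coordFun_id_projPoint_mk` — **`(xᵢ/xⱼ)([z]) = zᵢ/zⱼ`** for `zⱼ ≠ 0`: through the chart `Uⱼ = Spec ℂ[x]_{(xⱼ)}`
  (★ `projPoint_mk_eq_map_chartPoint`), the ratio `xᵢ/xⱼ` of the open immersion `Uⱼ → ℙᴺ` is the restriction of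
  the global section `xᵢ/xⱼ ∈ ℂ[x]_{(xⱼ)}` (uniqueness of lifts through `D₊(xⱼ)`), whose value at the chart point of
  `z` is `zᵢ/zⱼ` (★ `awayEval_awayMk`);
* `mem_chartDom_iff_of_map_eq_projPoint_mk`, `coordFun_eq_div_of_map_eq_projPoint_mk` — the same for ANY
  `ι : X ⟶ ℙᴺ_ℂ` and any `φ : M → X(ℂ)` lying over a map `F : M → ℙ(ℂ^{N+1})`, `ι(ℂ) ∘ φ = projPoint ∘ F`, with
  `F m = [g(m)]`: `m ∈ φ⁻¹(ι⁻¹D₊(xⱼ)(ℂ)) ↔ g(m)ⱼ ≠ 0` and `(ι^*(xᵢ/xⱼ))(φ m) = g(m)ᵢ/g(m)ⱼ`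
  (★ `coordFun_eq_coordFun_id_comp`, ★ `mem_chartDom_iff_comp`).
HC_CM is proved only modulo the 7 printed citations until rung 0 closes.

## References
* [Hartshorne1977] R. Hartshorne, *Algebraic Geometry* (GTM 52), II Prop. 2.5 (p. 76) and Thm. 7.1 (a) (p. 150).
* [SerreGAGA1956] J.-P. Serre, *Géométrie algébrique et géométrie analytique*, Ann. Inst. Fourier 6 (1956), §2 n°5.
-/

noncomputable section

open CategoryTheory AlgebraicGeometry TopologicalSpace Opposite HomogeneousLocalization
open MvPolynomial (X)
open scoped LinearAlgebra.Projectivization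

namespace Literature.AlgebraicGeometry.HodgeTheory

open Literature.AlgebraicGeometry.Motives Literature.AlgebraicGeometry.Motives.AlgPoints
  Literature.AlgebraicGeometry.Motives.AnalytificationKaehler Literature.AlgebraicGeometry.Motives.Segre
  Literature.NumberTheory.Transcendental

section ProjPoint

variable (N : ℕ)

/-- **`[z] ∈ (projPoint N)⁻¹(D₊(xⱼ)(ℂ))` iff `zⱼ ≠ 0`**: the chart domain of `xⱼ` for the identity of `ℙᴺ_ℂ`, read
on `ℙ(ℂ^{N+1})` through `projPoint`, is the standard chart `{zⱼ ≠ 0}`. [cite: SerreGAGA1956, §2 n°5]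
[cite: Hartshorne1977, II Prop. 2.5 (p. 76)] -/
theorem mem_chartDom_id_projPoint_mk_iff (z : Fin (N + 1) → ℂ) (hz : z ≠ 0) (j : Fin (N + 1)) :
    Projectivization.mk ℂ z hz ∈ chartDom (𝟙 (projectiveSpace N ℂ)) (projPoint N) j ↔ z j ≠ 0 := by
  letI := MvPolynomial.gradedAlgebra (σ := Fin (N + 1)) (R := ℂ)
  change (projPoint N (Projectivization.mk ℂ z hz)).pt ∈
      Proj.basicOpen (MvPolynomial.homogeneousSubmodule (Fin (N + 1)) ℂ) (X j) ↔ _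
  rw [pt_projPoint_mk_mem_basicOpen_iff N z hz one_pos (ProjectiveSpace.X_mem j), MvPolynomial.eval_X]

/-- The chart lift of the open immersion `Uⱼ = D₊(xⱼ) → ℙᴺ` over its own chart is the inclusion of the open
`Uⱼ ∩ Uⱼ⁻¹D₊(xⱼ) = Uⱼ` (uniqueness of lifts through the open immersion `D₊(xⱼ) → ℙᴺ`).
[cite: Hartshorne1977, II Prop. 2.5 (p. 76)] -/
theorem chartLift_chartι_left (j : Fin (N + 1)) :
    letI := MvPolynomial.gradedAlgebra (σ := Fin (N + 1)) (R := ℂ)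
    GeneratingSections.chartLift (chartι N j).left j = (GeneratingSections.preU (chartι N j).left j).ι := by
  letI := MvPolynomial.gradedAlgebra (σ := Fin (N + 1)) (R := ℂ)
  exact (IsOpenImmersion.lift_uniq (Segre.chartι ℂ j)
    ((GeneratingSections.preU (chartι N j).left j).ι ≫ (chartι N j).left) _
    (GeneratingSections.preU (chartι N j).left j).ι rfl).symm

/-- **`(xᵢ/xⱼ)([z]) = zᵢ/zⱼ`**: the affine coordinate `xᵢ/xⱼ` of `ℙᴺ_ℂ` (the ratio of the generating sections
`xᵢ`, `xⱼ` of `𝟙 ℙᴺ`, Hartshorne II Thm. 7.1 (a)) takes at the complex point with homogeneous coordinates `z`,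
`zⱼ ≠ 0`, the value `zᵢ/zⱼ`. [cite: Hartshorne1977, II Thm. 7.1 (a) (p. 150)] [cite: SerreGAGA1956, §2 n°5] -/
theorem coordFun_id_projPoint_mk (z : Fin (N + 1) → ℂ) {j : Fin (N + 1)} (hz : z j ≠ 0)
    (hz0 : z ≠ 0) (i : Fin (N + 1)) :
    coordFun (𝟙 (projectiveSpace N ℂ)) (projPoint N) j (Projectivization.mk ℂ z hz0) i = z i / z j := by
  letI := MvPolynomial.gradedAlgebra (σ := Fin (N + 1)) (R := ℂ)
  change evalOrZero ((GeneratingSections.affineChartData (𝟙 (projectiveSpace N ℂ))).U j)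
      ((GeneratingSections.affineChartData (𝟙 (projectiveSpace N ℂ))).ratio j i)
      (projPoint N (Projectivization.mk ℂ z (Function.ne_iff.mpr ⟨j, hz⟩))) = z i / z j
  rw [projPoint_mk_eq_map_chartPoint N z hz]
  -- the ratios of `𝟙 ℙᴺ` at `Uⱼ(z)` are those of the open immersion `Uⱼ → ℙᴺ` at the chart point of `z`
  have hcomp := GeneratingSections.evalOrZero_ratio_comp (chartι N j) (𝟙 (projectiveSpace N ℂ)) j i
    (chartPoint N z hz)
  rw [Category.comp_id] at hcomp
  rw [← hcomp]
  -- the chart point lies in `Uⱼ⁻¹D₊(xⱼ) = Uⱼ`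
  have hmem : (chartPoint N z hz).pt ∈ (GeneratingSections.affineChartData (chartι N j)).U j := by
    change (AlgPoints.map (chartι N j) (chartPoint N z hz)).pt ∈
      Proj.basicOpen (MvPolynomial.homogeneousSubmodule (Fin (N + 1)) ℂ) (X j)
    rw [map_chartι_chartPoint, pt_pointOfVec_mem_basicOpen_iff N _ _ one_pos (ProjectiveSpace.X_mem j),
      MvPolynomial.eval_X]
    exact hz
  rw [evalOrZero_of_mem _ hmem]
  change (chartPoint N z hz).eval (GeneratingSections.preU (chartι N j).left j) hmem
      (GeneratingSections.homRatio (chartι N j).left j i) = _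
  -- the ratio `xᵢ/xⱼ` of `Uⱼ → ℙᴺ` is the restriction of the global section `xᵢ/xⱼ ∈ ℂ[x]_{(xⱼ)}`
  have hratio : GeneratingSections.homRatio (chartι N j).left j i =
      (chartScheme N j).left.presheaf.map (homOfLE le_top).op
        ((Scheme.ΓSpecIso (.of _)).inv (frac ℂ j i)) := by
    change (GeneratingSections.preU (chartι N j).left j).topIso.hom
        (pull (GeneratingSections.chartLift (chartι N j).left j) (frac ℂ j i)) = _
    rw [chartLift_chartι_left]
    exact Motives.Scheme.Opens.topIso_hom_appTop _ _
  rw [hratio]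
  refine (AlgPoints.eval_map_homOfLE (X := chartScheme N j) (P := chartPoint N z hz) le_top _ hmem).trans ?_
  letI : Algebra ℂ (Away (MvPolynomial.homogeneousSubmodule (Fin (N + 1)) ℂ) (X j)) :=
    ProjBaseChange.algebraBase (MvPolynomial.homogeneousSubmodule (Fin (N + 1)) ℂ) (Submonoid.powers (X j))
  refine (AlgPoints.eval_ofAlgHom_top (awayEval N z hz) _ _).trans ?_
  rw [Iso.inv_hom_id_apply]
  change awayEval N z hz (Away.isLocalizationElem _ _) = _
  rw [Away.isLocalizationElem, awayEval_awayMk]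
  simp only [pow_one, MvPolynomial.eval_X]

end ProjPoint

/-! ### Any morphism to `ℙᴺ_ℂ` lying over a map to `ℙ(ℂ^{N+1})` -/

section OverProjPoint

variable {N : ℕ} {X : SchemeOver ℂ} (ι : X ⟶ projectiveSpace N ℂ) {M : Type*} (φ : M → ComplexPoints X)
  (F : M → ℙ ℂ (Fin (N + 1) → ℂ)) (hF : ∀ m, AlgPoints.map ι (φ m) = projPoint N (F m))
  (g : M → Fin (N + 1) → ℂ) (hg : ∀ m, g m ≠ 0) (hFg : ∀ m, F m = Projectivization.mk ℂ (g m) (hg m))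
include hF hFg

/-- **Chart domains of a morphism lying over `m ↦ [g(m)]`**: if `ι(ℂ)(φ m) = projPoint [g(m)]` for all `m`, then
`m ∈ φ⁻¹(ι⁻¹D₊(xⱼ)(ℂ))` iff `g(m)ⱼ ≠ 0`. [cite: Hartshorne1977, II Thm. 7.1 (a) (p. 150)] -/
theorem mem_chartDom_iff_of_map_eq_projPoint_mk (j : Fin (N + 1)) (m : M) :
    m ∈ chartDom ι φ j ↔ g m j ≠ 0 := by
  rw [mem_chartDom_iff_comp ι φ (projPoint N) F (fun m ↦ (hF m).symm) j m, hFg m]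
  exact mem_chartDom_id_projPoint_mk_iff N (g m) (hg m) j

/-- **Affine coordinates of a morphism lying over `m ↦ [g(m)]`**: if `ι(ℂ)(φ m) = projPoint [g(m)]` for all `m`,
then on the `j`-th chart domain `(ι^*(xᵢ/xⱼ))(φ m) = g(m)ᵢ/g(m)ⱼ`. [cite: Hartshorne1977, II Thm. 7.1 (a) (p. 150)]
[cite: SerreGAGA1956, §2 n°5] -/
theorem coordFun_eq_div_of_map_eq_projPoint_mk {j : Fin (N + 1)} {m : M} (hm : g m j ≠ 0) (i : Fin (N + 1)) :
    coordFun ι φ j m i = g m i / g m j := by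
  rw [coordFun_eq_coordFun_id_comp ι φ (projPoint N) F (fun m ↦ (hF m).symm) j, Function.comp_apply, hFg m]
  exact coordFun_id_projPoint_mk N (g m) hm (hg m) i

end OverProjPoint

end Literature.AlgebraicGeometry.HodgeTheory

end
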